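import Mathlib
import HarnessLib
import Literature.MathematicalPhysics.QuantumLattice.KohnLuttinger
import Summits.HubbardSuperconductivity.HubbardSuperconductivity.Theorems.WeakCouplingBCSKlThirdOrderFrequencyIntegrals

/-!
# Route `WeakCouplingBCS` — channel-margin lane of `WcbcsKohnLuttingerB1g` (stmt-HubbardSuperconductivity-0158):
# the zero-temperature Lindhard integrand IS (minus) the particle–hole pair frequency integral

The second-order Kohn–Luttinger kernel of item 0158 is `U² χ₀(k + k')` with the tree's static Lindhard function
`χ₀(q) = (2π)⁻² ∫_{BZ} lindhardIntegrand ε μ q p dp`, `lindhardIntegrand ε μ q p = (f(ε p) - f(ε (p+q)))/(ε (p+q) - ε p)`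
(`Literature/…/KohnLuttinger.lean`, RKS eq. (5); `f` the `T = 0` occupation).  In perturbation theory this integrand is the
frequency integral of the particle–hole bubble, `-(2π)⁻¹ ∫_ℝ dp₀ G(p₀, ξ_p) G(p₀, ξ_{p+q})` with `G(p₀, ξ) = (ip₀ - ξ)⁻¹` (the minus
sign is the fermion loop).  Using the residue lemma `FreqIntegral.integral_propagator_pair` of
`Theorems/WeakCouplingBCSKlThirdOrderFrequencyIntegrals.lean` we PROVE this identity for every dispersion `ε`, every `μ` and every
`p, q` off the two Fermi surfaces (`ε p ≠ μ`, `ε (p+q) ≠ μ` — the complement is the set where the tree's integrand takes its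
documented junk/removable values):

* `lindhardIntegrand_eq_neg_frequencyIntegral`:
  `lindhardIntegrand ε μ q p = -(2π)⁻¹ ∫_ℝ dp₀ (ip₀ - (ε p - μ))⁻¹ (ip₀ - (ε (p+q) - μ))⁻¹`.

So the SAME residue calculus underlies the certified second-order object (`χ₀`) and the third-order two-loop kernels
(`jV`/`jOcc`/`jEmp`, `Theorems/WeakCouplingBCSKlThirdOrderFrequencyIdentities.lean`).  Everything is proved; no definition;
nothing here asserts a pairing instability.

References: Raghu–Kivelson–Scalapino 2010 §II (5); standard many-body perturbation theory.
-/

noncomputable section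

-- the tree's namespace `Summit.<Summit>.<Problem>.Theorems` repeats the summit name by design (D-0017)
set_option linter.dupNamespace false

namespace Summit.HubbardSuperconductivity.HubbardSuperconductivity.Theorems

open MeasureTheory Complex Real Literature.MathematicalPhysics.QuantumLattice

namespace FreqIntegral

/-- **The `T = 0` Lindhard integrand is minus the particle–hole pair frequency integral**: for every dispersion `ε`, level `μ`,
transfer `q` and momentum `p` with `ε p ≠ μ`, `ε (p + q) ≠ μ`,
`lindhardIntegrand ε μ q p = -(2π)⁻¹ ∫_ℝ dp₀ (ip₀ - (ε p - μ))⁻¹ (ip₀ - (ε (p+q) - μ))⁻¹` (as complex numbers; the right side is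
real).  Occupied/empty ↔ the two poles in opposite half-planes ↔ `1/(|ξ_p| + |ξ_{p+q}|)`; both occupied or both empty ↔ `0`.
[cite: RaghuKivelsonScalapino2010, §II (5)] -/
theorem lindhardIntegrand_eq_neg_frequencyIntegral (ε : Momentum → ℝ) (μ : ℝ) (q p : Momentum)
    (hp : ε p ≠ μ) (hpq : ε (p + q) ≠ μ) :
    ((lindhardIntegrand ε μ q p : ℝ) : ℂ) =
      -(1 / (2 * π)) * ∫ t : ℝ, 1 / (I * (t : ℂ) - ((ε p - μ : ℝ) : ℂ)) * (1 / (I * (t : ℂ) - ((ε (p + q) - μ : ℝ) : ℂ))) := by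
  have ha : ε p - μ ≠ 0 := sub_ne_zero.2 hp
  have hb : ε (p + q) - μ ≠ 0 := sub_ne_zero.2 hpq
  have hπ : (π : ℝ) ≠ 0 := Real.pi_ne_zero
  rw [integral_propagator_pair ha hb]
  unfold lindhardIntegrand fermiOccupation
  rcases lt_or_gt_of_ne ha with ha' | ha'
  · have h1 : ε p < μ := by linarith
    rcases lt_or_gt_of_ne hb with hb' | hb'
    · -- both states occupied
      have h2 : ε (p + q) < μ := by linarith
      rw [if_pos h1, if_pos h2, if_pos rfl, if_neg (not_lt.2 (le_of_lt (mul_pos_of_neg_of_neg ha' hb')))]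
      push_cast
      ring
    · -- `p` occupied, `p + q` empty
      have h2 : ¬ε (p + q) < μ := by linarith
      rw [if_pos h1, if_neg h2, if_neg (by norm_num), if_pos (mul_neg_of_neg_of_pos ha' hb'), abs_of_neg ha',
        abs_of_pos hb']
      have h3 : ((ε (p + q) : ℂ) - (ε p : ℂ)) ≠ 0 := by
        exact_mod_cast (show ε (p + q) - ε p ≠ 0 by linarith)
      have h4 : (-((ε p : ℂ) - μ) + ((ε (p + q) : ℂ) - μ)) ≠ 0 := by
        exact_mod_cast (show -(ε p - μ) + (ε (p + q) - μ) ≠ 0 by linarith)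
      push_cast
      field_simp
      ring
  · have h1 : ¬ε p < μ := by linarith
    rcases lt_or_gt_of_ne hb with hb' | hb'
    · -- `p` empty, `p + q` occupied
      have h2 : ε (p + q) < μ := by linarith
      rw [if_neg h1, if_pos h2, if_neg (by norm_num), if_pos (mul_neg_of_pos_of_neg ha' hb'), abs_of_pos ha',
        abs_of_neg hb']
      have h3 : ((ε (p + q) : ℂ) - (ε p : ℂ)) ≠ 0 := by
        exact_mod_cast (show ε (p + q) - ε p ≠ 0 by linarith)
      have h4 : (((ε p : ℂ) - μ) + -((ε (p + q) : ℂ) - μ)) ≠ 0 := by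
        exact_mod_cast (show (ε p - μ) + -(ε (p + q) - μ) ≠ 0 by linarith)
      push_cast
      field_simp
      ring
    · -- both states empty
      have h2 : ¬ε (p + q) < μ := by linarith
      rw [if_neg h1, if_neg h2, if_pos rfl, if_neg (not_lt.2 (le_of_lt (mul_pos ha' hb')))]
      push_cast
      ring

/-- Real form: off the two Fermi surfaces, `lindhardIntegrand ε μ q p = 𝟙[ξ_p ξ_{p+q} < 0]/(|ξ_p| + |ξ_{p+q}|)`, `ξ = ε - μ` — the value
of (minus) the pair frequency integral divided by `2π`. [cite: RaghuKivelsonScalapino2010, §II (5)] -/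
theorem lindhardIntegrand_eq_indicator_div (ε : Momentum → ℝ) (μ : ℝ) (q p : Momentum)
    (hp : ε p ≠ μ) (hpq : ε (p + q) ≠ μ) :
    lindhardIntegrand ε μ q p =
      if (ε p - μ) * (ε (p + q) - μ) < 0 then 1 / (|ε p - μ| + |ε (p + q) - μ|) else 0 := by
  have ha : ε p - μ ≠ 0 := sub_ne_zero.2 hp
  have hb : ε (p + q) - μ ≠ 0 := sub_ne_zero.2 hpq
  unfold lindhardIntegrand fermiOccupation
  rcases lt_or_gt_of_ne ha with ha' | ha'
  · have h1 : ε p < μ := by linarith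
    rcases lt_or_gt_of_ne hb with hb' | hb'
    · have h2 : ε (p + q) < μ := by linarith
      rw [if_pos h1, if_pos h2, if_pos rfl, if_neg (not_lt.2 (le_of_lt (mul_pos_of_neg_of_neg ha' hb')))]
    · have h2 : ¬ε (p + q) < μ := by linarith
      rw [if_pos h1, if_neg h2, if_neg (by norm_num), if_pos (mul_neg_of_neg_of_pos ha' hb'), abs_of_neg ha',
        abs_of_pos hb']
      have h3 : ε (p + q) - ε p ≠ 0 := by linarith
      have h4 : -(ε p - μ) + (ε (p + q) - μ) ≠ 0 := by linarith
      field_simp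
      ring
  · have h1 : ¬ε p < μ := by linarith
    rcases lt_or_gt_of_ne hb with hb' | hb'
    · have h2 : ε (p + q) < μ := by linarith
      rw [if_neg h1, if_pos h2, if_neg (by norm_num), if_pos (mul_neg_of_pos_of_neg ha' hb'), abs_of_pos ha',
        abs_of_neg hb']
      have h3 : ε (p + q) - ε p ≠ 0 := by linarith
      have h4 : (ε p - μ) + -(ε (p + q) - μ) ≠ 0 := by linarith
      field_simp
      ring
    · have h2 : ¬ε (p + q) < μ := by linarith
      rw [if_neg h1, if_neg h2, if_pos rfl, if_neg (not_lt.2 (le_of_lt (mul_pos ha' hb')))]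

end FreqIntegral

end Summit.HubbardSuperconductivity.HubbardSuperconductivity.Theorems

end
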